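import Summits.Ventures.HodgeRepro2.T5RecordSatakeCell
import Summits.Ventures.HodgeRepro2.T5RecordSatakeInert
import Summits.Ventures.HodgeRepro2.T5CMFieldSquareDatum

/-!
# The explicit generator at every place that stays prime, with and without the datum

Tier-5 support N3 / §G-N4.2 (seat p3, gen 77). File 241 exhibits, at an inert good place, an explicit double
coset `K_v g₀ K_v` whose characteristic function generates the record's spherical Hecke algebra — under seat p8's
standing local hypotheses on the completions. File 233's method discharges every one of them from the single global
hypothesis `v 𝓞_K = w`; file 235 supplies the datum `(θ, y)`. Hence:

* **`exists_cell_doubleCosetOp_aeval_bijective_record_of_staysPrime`** — at every place `v` of `K⁺` that stays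
  prime in `K` and is good for `H`: a unit `u₀`, an integral change of basis `P` with `Pᴴ H_w P = J₃(u₀)`, a
  uniformiser `ϖ'` of `𝒪_{E_v}` and `g₀ ∈ U(1 ⊗ H)` mapping to `P · diag(ϖ', 1, ϖ'⁻¹) · P⁻¹`, whose double coset is
  finite and generates: `aeval (T_{g₀}) : k[X] →ₐ[k] H(U(1 ⊗ H), K_v)` is bijective;
* **`exists_doubleCosetOp_aeval_bijective_record_of_staysPrime`** — with the datum `(θ, y)` gone (chosen from
  file 235 inside the proof): some `g₀` has a finite double coset whose characteristic function generates.

§8(d): uses an L-value-free non-vanishing device: NO.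
-/

open Matrix NumberField NumberField.IsCMField IsDedekindDomain IsDedekindDomain.HeightOneSpectrum Module Polynomial
  MulAction
open scoped TensorProduct Pointwise
open Summit.Ventures.HodgeRepro2.T5UnitaryGroupForm Summit.Ventures.HodgeRepro2.T5UnitaryHeckeAdjoint
  Summit.Ventures.HodgeRepro2.T5HeckePermutationModule Summit.Ventures.HodgeRepro2.T5StarOfInvolution
  Summit.Ventures.HodgeRepro2.T5FinitePlaceCM Summit.Ventures.HodgeRepro2.T5FinitePlaceNormIndex
  Summit.Ventures.HodgeRepro2.T5NonSplitPlaceUnitaryGroup Summit.Ventures.HodgeRepro2.T5RecordHyperspecial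
  Summit.Ventures.HodgeRepro2.T5GlobalLatticeAlmostAll Summit.Ventures.HodgeRepro2.T5HermitianLocalIsotropyN3
  Summit.Ventures.HodgeRepro2.T5FinitePlaceSplitClassification Summit.Ventures.HodgeRepro2.T5HermitianThreeElements
  Summit.Ventures.HodgeRepro2.T5InertPlaceCompletion Summit.Ventures.HodgeRepro2.T5InertPlaceCompletionCells
  Summit.Ventures.HodgeRepro2.T5HeckeDoubleCoset Summit.Ventures.HodgeRepro2.T5CartanCellsDistinct
  Summit.Ventures.HodgeRepro2.T5RecordSatake Summit.Ventures.HodgeRepro2.T5RecordSatakeInert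
  Summit.Ventures.HodgeRepro2.T5RecordSatakeCell Summit.Ventures.HodgeRepro2.T5CMFieldSquareDatum
  Summit.Ventures.HodgeRepro2.T5SplitPlaceUnitaryGroup Summit.Ventures.HodgeRepro2.T5GaloisCartanThree
  Summit.Ventures.HodgeRepro2.T5InertDegreeGalois Summit.Ventures.HodgeRepro2.T5InertDegreeCompletion
  Summit.Ventures.HodgeRepro2.T5InertDegreeAdicCompletion Summit.Ventures.HodgeRepro2.T5InertSatakeTransform
  Summit.Ventures.HodgeRepro2.T5InertTopCoefficient Summit.Ventures.HodgeRepro2.T5SplitUnitaryGroupEquiv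

namespace Summit.Ventures.HodgeRepro2.T5RecordSatakeCellIntrinsic

section Record

variable (K : Type*) [Field K] [NumberField K] [IsCMField K]
variable (v : HeightOneSpectrum (𝓞 (maximalRealSubfield K))) (w : HeightOneSpectrum (𝓞 K))
  [w.asIdeal.LiesOver v.asIdeal]
variable {θ : maximalRealSubfield K} {y : K}
  (hθ : algebraMap (maximalRealSubfield K) K θ = y ^ 2) (hy : complexConj K y ≠ y)
  (hmap : Ideal.map (algebraMap (𝓞 (maximalRealSubfield K)) (𝓞 K)) v.asIdeal = w.asIdeal)
variable {r : ℕ} (l : Fin r → 𝓞 K)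

include hθ hy hmap in
/-- **THE EXPLICIT GENERATOR AT EVERY PLACE THAT STAYS PRIME**: for the datum's `3 × 3` hermitian invertible Gram
matrix `H` over `K` and a place `v` of `K⁺` with `v 𝓞_K = w`, good for `H`, there are `u₀ ∈ 𝒪_{K⁺_v}ˣ`, an integral
change of basis `P` with `Pᴴ H_w P = J₃(u₀)`, a uniformiser `ϖ'` of `𝒪_{E_v}` and `g₀ ∈ U(1 ⊗ H)` mapping to
`P · diag(ϖ', 1, ϖ'⁻¹) · P⁻¹` in `U(H_w)`, with `K_v g₀ K_v` finite and `aeval (T_{g₀})` bijective — file 241 with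
its local hypotheses discharged by file 233's method. -/
theorem exists_cell_doubleCosetOp_aeval_bijective_record_of_staysPrime (k : Type*) [Field k]
    (hl : Submodule.span (𝓞 (maximalRealSubfield K)) (Set.range l) = ⊤)
    {H : Matrix (Fin 3) (Fin 3) K} (hH : H.IsHermitian) (hdet : IsUnit H.det) (hgood : w ∉ badSet H) :
    letI := tensorStarRing K v
    letI := starRingOfQuadratic (finrank_eq_two K v w hθ hy (not_isSquare_of_staysPrime K v w hθ hy hmap))
      (localConj v w hθ.symm (span_pair_eq_top K hy) (not_isSquare_of_staysPrime K v w hθ hy hmap) (complexConj K))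
      (localConj_ne_one v w hθ.symm (span_pair_eq_top K hy) (not_isSquare_of_staysPrime K v w hθ hy hmap)
        (complexConj K) (complexConj_apply_eq_neg K hθ hy))
    haveI : IsFractionRing (integralClosure (v.adicCompletionIntegers (maximalRealSubfield K)) (w.adicCompletion K))
      (w.adicCompletion K) :=
      integralClosure.isFractionRing_of_finite_extension (v.adicCompletion (maximalRealSubfield K))
        (w.adicCompletion K)
    ∃ (u₀ : (v.adicCompletionIntegers (maximalRealSubfield K))ˣ) (P : GL (Fin 3) (w.adicCompletion K))
      (g₀ : ↥(formUnitaryGroup (tensorGram K v H))),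
      P ∈ (Matrix.GeneralLinearGroup.map (algebraMap
        (integralClosure (v.adicCompletionIntegers (maximalRealSubfield K)) (w.adicCompletion K))
        (w.adicCompletion K))).range ∧
      (P : Matrix (Fin 3) (Fin 3) (w.adicCompletion K))ᴴ * H.map (algebraMap K (w.adicCompletion K)) * P =
        J3 (algebraMap (v.adicCompletionIntegers (maximalRealSubfield K)) (w.adicCompletion K)
          (u₀ : v.adicCompletionIntegers (maximalRealSubfield K))) ∧
      (∃ (ϖ' : integralClosure (v.adicCompletionIntegers (maximalRealSubfield K)) (w.adicCompletion K))
        (hϖ' : Irreducible ϖ'),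
        ((recordNonSplitEquiv' K v w hθ hy (not_isSquare_of_staysPrime K v w hθ hy hmap) H g₀ :
          ↥(formUnitaryGroup (H.map (algebraMap K (w.adicCompletion K))))) : GL (Fin 3) (w.adicCompletion K)) =
          P * cell hϖ' 1 * P⁻¹) ∧
      ∃ _ : Finite (orbit (recordHyperspecial K v l H) (g₀ : _ ⧸ recordHyperspecial K v l H)),
        Function.Bijective (aeval (doubleCosetOp k (recordHyperspecial K v l H) g₀) :
          k[X] →ₐ[k] heckeAlgebra k (recordHyperspecial K v l H)) :=
  haveI := isDiscreteValuationRing_integralClosure_adicCompletion v w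
  haveI := finite_residueField_integralClosure_adicCompletion v w
  haveI : IsFractionRing (integralClosure (v.adicCompletionIntegers (maximalRealSubfield K)) (w.adicCompletion K))
      (w.adicCompletion K) :=
    integralClosure.isFractionRing_of_finite_extension (v.adicCompletion (maximalRealSubfield K)) (w.adicCompletion K)
  (exists_irreducible_and_irreducible_algebraMap_of_staysPrime K v w hmap).elim fun _ h =>
    (exists_cell_doubleCosetOp_aeval_bijective_record K v w hθ hy (not_isSquare_of_staysPrime K v w hθ hy hmap)
      h.1 h.2 l k hl hH hdet hgood).elim fun u₀ h1 => h1.elim fun P h2 => h2.elim fun g₀ h3 =>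
      ⟨u₀, P, g₀, h3.1, h3.2.1, ⟨_, irreducible_uniformiser
        (map_maximalIdeal_integralClosure_eq_of_irreducible v w h.1 h.2) h.1, h3.2.2.1⟩, h3.2.2.2⟩

omit hθ hy in
include hmap in
/-- **THE DOUBLE-COSET GENERATOR AT EVERY PLACE THAT STAYS PRIME, WITH NO AUXILIARY DATUM**: at every place `v` of
`K⁺` with `v 𝓞_K = w`, good for `H`, some `g₀ ∈ U(1 ⊗ H)` has a finite double coset `K_v g₀ K_v` whose
characteristic function generates `H(U(1 ⊗ H), K_v)` (the datum `(θ, y)` of file 235 chosen inside the proof; the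
description of `g₀` as a conjugated Cartan cell is the previous theorem's). -/
theorem exists_doubleCosetOp_aeval_bijective_record_of_staysPrime (k : Type*) [Field k]
    (hl : Submodule.span (𝓞 (maximalRealSubfield K)) (Set.range l) = ⊤)
    {H : Matrix (Fin 3) (Fin 3) K} (hH : H.IsHermitian) (hdet : IsUnit H.det) (hgood : w ∉ badSet H) :
    ∃ (g₀ : (letI := tensorStarRing K v; ↥(formUnitaryGroup (tensorGram K v H))))
      (_ : Finite (orbit (recordHyperspecial K v l H) (g₀ : _ ⧸ recordHyperspecial K v l H))),
      Function.Bijective (aeval (doubleCosetOp k (recordHyperspecial K v l H) g₀) :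
        k[X] →ₐ[k] heckeAlgebra k (recordHyperspecial K v l H)) :=
  (exists_sq_eq_and_complexConj_ne K).elim fun _ h => h.elim fun _ h =>
    (exists_cell_doubleCosetOp_aeval_bijective_record_of_staysPrime K v w h.1 h.2 hmap l k hl hH hdet hgood).elim
      fun _ h1 => h1.elim fun _ h2 => h2.elim fun g₀ h3 => ⟨g₀, h3.2.2.2⟩

end Record

end Summit.Ventures.HodgeRepro2.T5RecordSatakeCellIntrinsic
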